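import Literature.Analysis.FluidPDE.StokesMollified
import Literature.Analysis.FluidPDE.NSSuitableESSProofs
import Literature.Analysis.FluidPDE.WholeSpaceIBP
import HarnessLib

/-!
# The transport identity `∫∫ ⟪∇u·X, u⟫ = -½ ∫∫ |u|² div X` for fields with an `L²_loc` weak
  spatial gradient

Analysis/FluidPDE proof file (theorems only; no definitions, no named facts). Let `Q ⊆ ℝ × E` be
open (`E` a finite-dimensional real inner product space), let `u : ℝ → E → E` have the weak
spatial gradient `G = ∇u` on `Q` (`HasWeakSpatialGradientOn Q u G`) with `|u|², |G|² ∈ L¹_loc(Q)`,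
and let `X : ℝ → E → E` be a vector field supported in a compact `K ⊆ Q`, of class `C¹` in the
space variable for every time, jointly measurable together with its spatial divergence, with `X`
and `div X` bounded — **no regularity in time is assumed** (the drifts this is written for, e.g.
the mollified velocity `η_ε * U(s)` of Bradshaw–Tsai's or Leray's schemes cut off by a test
function, are smooth in space and merely measurable in time). Then

  `∫∫_Q ⟪G (X), u⟫ = -½ ∫∫_Q |u|² div X`

(`HasWeakSpatialGradientOn.integral_inner_apply_field_eq`), the weak form of the pointwise
identity `⟪(X·∇)u, u⟫ = ½ X·∇|u|² = ½ div(|u|² X) - ½ |u|² div X`. Two specialisations, the ones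
met when a local energy balance is derived from an equation with drift and dilation terms
(Caffarelli–Kohn–Nirenberg 1982, §2: "`∫∫ |u|² (u·∇φ)`" arises from `⟪(u·∇)u, uφ⟫`; Bradshaw–Tsai
2017, proof of Thm. 2.4, the local energy equality of the mollified approximants with the terms
`b·∇U` and `y·∇u`):

* `HasWeakSpatialGradientOn.integral_inner_apply_drift_mul_eq` — for a divergence-free drift
  `b` (spatially `C¹`, measurable, bounded on `supp φ`) and a test function `φ ∈ C_c^∞(Q)`,
  `∫∫_Q ⟪G (b), u⟫ φ = -½ ∫∫_Q |u|² ⟪b, ∇φ⟫`;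
* `HasWeakSpatialGradientOn.integral_inner_apply_self_mul_eq` — the dilation term,
  `∫∫_Q ⟪G (y), u⟫ φ = -½ ∫∫_Q |u|² (n φ + ⟪y, ∇φ⟫)`, `n = dim E`.

## The argument

As in the tree's local energy equality for the Stokes system (`StokesLocalEnergyEquality`):
localise to a bounded open `Q₀ ⋐ Q` containing `K` on which `u, G ∈ L²`, extend by zero and
mollify in space–time (`stMollify`); for radii below `dist(K, ∂Q₀)` the mollified fields satisfy
`∇(u)ₙ = (G)ₙ` on `K` (`HasWeakSpatialGradientOn.fderiv_mollified`). For the smooth `(u)ₙ` and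
each fixed time the identity is the divergence theorem without boundary
(`integral_mul_divergence_add_eq_zero_right` with `θ = ½|V|²`, `∇θ = (DV)ᵀV`;
`integral_inner_fderiv_apply_eq_of_hasCompactSupport`); it is integrated in time (Fubini, the
integrands being bounded and supported in `K`), and the limit `n → ∞` is taken term by term:
`⟪Gₙ X, Vₙ⟫ = Σᵢ ⟪X, eᵢ⟫ ⟪Gₙ eᵢ, Vₙ⟫` and `|Vₙ|² div X` are bounded measurable weights against
bilinear expressions of two `L²`-convergent sequences (`MollifiedLimits`).

## Mathlib / tree search

Tree (all used): `HasWeakSpatialGradientOn` with `.mono`, `.fderiv_mollified`, `stMollify`,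
`zeroExt`, `contDiff_uncurry_stMollify`, `contDiff_stMollify_slice` (`SuitableWeak`,
`SpaceTimeMollifier`); `integral_mul_divergence_add_eq_zero_right`, `divergence_smul_apply`
(`WholeSpaceIBP`); `divergence_eq_sum_inner_fderiv` (`VectorCalculus`);
`tendsto_setIntegral_mul_bilin`, `integrable_mul_bilin_of_memLp` (`MollifiedLimits`);
`memLp_two_of_frobeniusNormSq`, `memLp_zeroExt` (`NSSuitableESSProofs`);
`FunctionSpaces.exists_contDiffBump_seq`, `FunctionSpaces.tendsto_eLpNorm_normed_convolution_sub_self`,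
`UnboundedOperators.memLp_convolution_lsmul`. `lean search` for `divergence` next to `‖u‖ ^ 2`,
`inner_weakGrad`, `transport.*identity`: the tree has the whole-space slice skew-symmetry
`integral_inner_weakGrad_apply_self_eq_zero` (`TrilinearSkew`, divergence-free drift, no weight)
and classical weighted versions for smooth fields (`AncientSimilarityVorticity`), not the weighted
space–time identity for weak gradients. Mathlib: `HasFDerivAt.norm_sq`,
`IsCompact.exists_cthickening_subset_open`, `integral_prod`, `Measure.integrableOn_of_bounded`.

## References

* L. Caffarelli, R. Kohn, L. Nirenberg, *Partial regularity of suitable weak solutions of the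
  Navier–Stokes equations*, CPAM 35 (1982), §2, (2.5) (the transport term `|u|²(u·∇φ)`).
  [CaffarelliKohnNirenberg1982]
* Z. Bradshaw, T.-P. Tsai, Ann. Henri Poincaré 18 (2017), proof of Thm. 2.4 (local energy
  equality of the approximants: drift `b·∇U`, dilation `y·∇u`). [BradshawTsai2017AHP]
* L. C. Evans, *Partial Differential Equations* (2010), §5.3.1 Thm. 1, App. C.2 Thm. 2.
  [Evans2010]
-/

noncomputable section

open MeasureTheory TopologicalSpace Set Function Filter Topology ContinuousLinearMap Metric
  InnerProductSpace Module
open scoped ENNReal NNReal Convolution RealInnerProductSpace ContDiff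

namespace Literature.Analysis.FluidPDE

variable {E : Type*} [NormedAddCommGroup E] [InnerProductSpace ℝ E] [FiniteDimensional ℝ E]
  [MeasurableSpace E] [BorelSpace E]

/-! ### The identity for smooth fields at a fixed time -/

section Smooth

omit [MeasurableSpace E] [BorelSpace E] in
/-- `⟪X, ∇(½⟪V, V⟫)⟫ = ⟪DV X, V⟫` for a `C¹` field `V`. [folklore] -/
theorem inner_gradient_half_inner_self {V : E → E} (hV : ContDiff ℝ 1 V) (X y : E) :
    ⟪X, gradient (fun y => (1 / 2 : ℝ) * ⟪V y, V y⟫) y⟫ = ⟪fderiv ℝ V y X, V y⟫ := by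
  have hd : DifferentiableAt ℝ V y := hV.differentiable one_ne_zero y
  rw [real_inner_comm, gradient, InnerProductSpace.toDual_symm_apply,
    fderiv_const_mul (hd.inner ℝ hd), _root_.smul_apply, fderiv_inner_apply ℝ hd hd,
    smul_eq_mul, real_inner_comm (V y)]
  ring

/-- **The transport identity for smooth fields at a fixed time**: for `V ∈ C¹(E; E)` and a
compactly supported `X ∈ C¹_c(E; E)`, `∫ ⟪DV X, V⟫ = -½ ∫ |V|² div X` — the divergence theorem
without boundary applied to `½|V|² X` (Evans, App. C.2 Thm. 2; the computation behind the
transport term of Caffarelli–Kohn–Nirenberg's (2.5)). [cite: CaffarelliKohnNirenberg1982, §2 (2.5)] -/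
theorem integral_inner_fderiv_apply_eq_of_hasCompactSupport {V X : E → E} (hV : ContDiff ℝ 1 V)
    (hX : ContDiff ℝ 1 X) (hXc : HasCompactSupport X) :
    ∫ y, ⟪fderiv ℝ V y (X y), V y⟫ =
      -(1 / 2 : ℝ) * ∫ y, ‖V y‖ ^ 2 * VectorCalculus.divergence X y := by
  have hθ : ContDiff ℝ 1 (fun y => (1 / 2 : ℝ) * ⟪V y, V y⟫) := contDiff_const.mul (hV.inner ℝ hV)
  have h := integral_mul_divergence_add_eq_zero_right hθ hX hXc
  simp_rw [inner_gradient_half_inner_self hV, real_inner_self_eq_norm_sq] at h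
  have e : ∫ y, (1 / 2 : ℝ) * ‖V y‖ ^ 2 * VectorCalculus.divergence X y =
      (1 / 2 : ℝ) * ∫ y, ‖V y‖ ^ 2 * VectorCalculus.divergence X y := by
    rw [← integral_const_mul]
    refine integral_congr_ae (Eventually.of_forall fun y => ?_)
    simp only [mul_assoc]
  rw [e] at h
  linarith

end Smooth

/-! ### Slices of compact space–time sets and fields supported in them -/

section Slices

omit [InnerProductSpace ℝ E] [FiniteDimensional ℝ E] [MeasurableSpace E] [BorelSpace E] in
/-- A field vanishing off a compact space–time set has compactly supported time slices. [folklore] -/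
theorem hasCompactSupport_slice_of_compact {F : Type*} [Zero F] [TopologicalSpace F]
    {K : Set (ℝ × E)} (hK : IsCompact K)
    {X : ℝ → E → F} (hXK : ∀ s y, (s, y) ∉ K → X s y = 0) (s : ℝ) : HasCompactSupport (X s) := by
  refine HasCompactSupport.intro (hK.image continuous_snd) fun y hy => hXK s y fun h => ?_
  exact hy ⟨(s, y), h, rfl⟩

omit [FiniteDimensional ℝ E] [MeasurableSpace E] [BorelSpace E] in
/-- A field vanishing off a closed space–time set vanishes near every point outside it, slice-wise:
its spatial derivative vanishes there. [folklore] -/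
theorem fderiv_slice_eq_zero_of_notMem {F : Type*} [NormedAddCommGroup F] [NormedSpace ℝ F]
    {K : Set (ℝ × E)} (hK : IsClosed K) {X : ℝ → E → F} (hXK : ∀ s y, (s, y) ∉ K → X s y = 0)
    {s : ℝ} {y : E} (h : (s, y) ∉ K) : fderiv ℝ (X s) y = 0 := by
  have hev : (X s) =ᶠ[𝓝 y] fun _ => 0 := by
    have ho : IsOpen {y' : E | (s, y') ∉ K} :=
      hK.isOpen_compl.preimage (Continuous.prodMk_right s)
    filter_upwards [ho.mem_nhds h] with y' hy'
    exact hXK s y' hy'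
  rw [hev.fderiv_eq, fderiv_const_apply]

omit [FiniteDimensional ℝ E] [MeasurableSpace E] [BorelSpace E] in
/-- The divergence of a field vanishing off a closed space–time set vanishes off that set. [folklore] -/
theorem divergence_slice_eq_zero_of_notMem {K : Set (ℝ × E)} (hK : IsClosed K) {X : ℝ → E → E}
    (hXK : ∀ s y, (s, y) ∉ K → X s y = 0) {s : ℝ} {y : E} (h : (s, y) ∉ K) :
    VectorCalculus.divergence (X s) y = 0 := by
  rw [VectorCalculus.divergence, fderiv_slice_eq_zero_of_notMem hK hXK h]
  simp

/-- A measurable function vanishing off a set of finite measure and a.e. bounded is integrable. [folklore] -/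
theorem integrable_of_bounded_of_support_subset {α F : Type*} [MeasurableSpace α]
    [NormedAddCommGroup F] {μ : Measure α} {K : Set α} (hKμ : μ K ≠ ⊤)
    {g : α → F} (hgm : AEStronglyMeasurable g μ) (hgK : ∀ z, z ∉ K → g z = 0) {C : ℝ}
    (hC : ∀ᵐ z ∂μ, ‖g z‖ ≤ C) : Integrable g μ := by
  have hi : IntegrableOn g K μ :=
    Measure.integrableOn_of_bounded hKμ hgm (ae_restrict_of_ae hC)
  exact hi.integrable_of_forall_notMem_eq_zero hgK

end Slices

/-! ### The space–time identity for fields with an `L²_loc` weak spatial gradient -/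

section Main

variable {Q : Opens (ℝ × E)} {u : ℝ → E → E} {G : ℝ → E → E →L[ℝ] E}

set_option maxHeartbeats 800000 in
/-- **The transport identity `∫∫_Q ⟪G (X), u⟫ = -½ ∫∫_Q |u|² div X` for fields with an `L²_loc`
weak spatial gradient.** Let `u` have the weak spatial gradient `G` on the open set `Q ⊆ ℝ × E`,
with `|u|²` and `|G|²` integrable on the compact subsets of `Q`; let the field `X : ℝ → E → E`
vanish off a compact `K ⊆ Q`, be `C¹` in space for every time, be jointly (a.e. strongly)
measurable together with its spatial divergence, with `|X| ≤ C_X` and `|div X| ≤ C_d` a.e. Then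
`∫∫_Q ⟪G (X), u⟫ = -½ ∫∫_Q |u|² div X` — the weak form of `⟪(X·∇)u, u⟫ = ½ div(|u|²X) - ½|u|² div X`,
by space–time mollification (`∇(u)ₙ = (G)ₙ` near `K`, Evans §5.3.1 Thm. 1), the smooth slice
identity `integral_inner_fderiv_apply_eq_of_hasCompactSupport`, Fubini, and `L²` limits. No time
regularity of `X` is needed. [cite: CaffarelliKohnNirenberg1982, §2 (2.5); Evans2010, §5.3.1 Thm. 1 and App. C.2 Thm. 2] -/
theorem HasWeakSpatialGradientOn.integral_inner_apply_field_eq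
    (hG : HasWeakSpatialGradientOn Q u G)
    (hu2 : LocallyIntegrableOn (fun z : ℝ × E => ‖u z.1 z.2‖ ^ 2) (Q : Set (ℝ × E)) volume)
    (hG2 : LocallyIntegrableOn (fun z : ℝ × E => frobeniusNormSq (G z.1 z.2)) (Q : Set (ℝ × E))
      volume)
    {X : ℝ → E → E} {K : Set (ℝ × E)} (hK : IsCompact K) (hKQ : K ⊆ (Q : Set (ℝ × E)))
    (hXK : ∀ s y, (s, y) ∉ K → X s y = 0) (hX1 : ∀ s, ContDiff ℝ 1 (X s))
    (hXm : AEStronglyMeasurable (uncurry X) (volume : Measure (ℝ × E)))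
    (hdm : AEStronglyMeasurable (fun z : ℝ × E => VectorCalculus.divergence (X z.1) z.2)
      (volume : Measure (ℝ × E)))
    {CX : ℝ} (hCX : ∀ᵐ z : ℝ × E, ‖X z.1 z.2‖ ≤ CX)
    {Cd : ℝ} (hCd : ∀ᵐ z : ℝ × E, |VectorCalculus.divergence (X z.1) z.2| ≤ Cd) :
    ∫ z in (Q : Set (ℝ × E)), ⟪G z.1 z.2 (X z.1 z.2), u z.1 z.2⟫ =
      -(1 / 2 : ℝ) * ∫ z in (Q : Set (ℝ × E)),
        ‖u z.1 z.2‖ ^ 2 * VectorCalculus.divergence (X z.1) z.2 := by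
  haveI : (volume : Measure (ℝ × E)).IsAddHaarMeasure := Measure.prod.instIsAddHaarMeasure _ _
  set b := stdOrthonormalBasis ℝ E with hb
  have hQm : MeasurableSet (Q : Set (ℝ × E)) := Q.isOpen.measurableSet
  have hKc : IsClosed K := hK.isClosed
  -- ## (0) a margin `δ` and the localisation `Q₀ = K_δ ⋐ Q`
  obtain ⟨δ, hδ, hδQ⟩ := hK.exists_cthickening_subset_open Q.isOpen hKQ
  set S : Set (ℝ × E) := thickening δ K with hS_def
  set C : Set (ℝ × E) := cthickening δ K with hC_def
  have hC : IsCompact C := hK.cthickening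
  have hSC : S ⊆ C := thickening_subset_cthickening δ K
  have hCQ : C ⊆ (Q : Set (ℝ × E)) := hδQ
  have hSQ : S ⊆ (Q : Set (ℝ × E)) := hSC.trans hCQ
  have hKS : K ⊆ S := self_subset_thickening hδ K
  have hSo : IsOpen S := isOpen_thickening
  have hSm : MeasurableSet S := hSo.measurableSet
  have hSbdd : Bornology.IsBounded S := hK.isBounded.thickening
  set Q₀ : Opens (ℝ × E) := ⟨S, hSo⟩ with hQ₀_def
  have hQ₀S : (Q₀ : Set (ℝ × E)) = S := rfl
  have hQ₀Q : Q₀ ≤ Q := fun z hz => hSQ hz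
  have hballS : ∀ z ∈ K, ∀ r, r < δ → closedBall z r ⊆ (Q₀ : Set (ℝ × E)) := fun z hz r hr =>
    (closedBall_subset_ball hr).trans (ball_subset_thickening hz δ)
  haveI : IsFiniteMeasure (volume.restrict S) := by
    refine ⟨?_⟩
    rw [Measure.restrict_apply_univ]
    exact hSbdd.measure_lt_top
  -- ## (1) the classes of `u`, `G` on `S`
  have hum : AEStronglyMeasurable (uncurry u) (volume.restrict S) :=
    hG.locallyIntegrableOn.aestronglyMeasurable.mono_measure (Measure.restrict_mono hSQ le_rfl)
  have hGm : AEStronglyMeasurable (uncurry G) (volume.restrict S) :=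
    hG.locallyIntegrableOn_grad.aestronglyMeasurable.mono_measure (Measure.restrict_mono hSQ le_rfl)
  have hu2S : MemLp (uncurry u) 2 (volume.restrict S) :=
    (memLp_two_iff_integrable_sq_norm hum).2
      ((hu2.integrableOn_compact_subset hCQ hC).mono_set hSC)
  have hG2S : MemLp (uncurry G) 2 (volume.restrict S) := by
    refine memLp_two_of_frobeniusNormSq hGm ?_
    have hi : IntegrableOn (fun z : ℝ × E => frobeniusNormSq (G z.1 z.2)) S volume :=
      (hG2.integrableOn_compact_subset hCQ hC).mono_set hSC
    refine lt_of_le_of_lt (lintegral_ofReal_le_lintegral_enorm _) hi.2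
  have huI : IntegrableOn (uncurry u) (Q₀ : Set (ℝ × E)) volume := hu2S.integrable one_le_two
  have hGI : IntegrableOn (uncurry G) (Q₀ : Set (ℝ × E)) volume := hG2S.integrable one_le_two
  -- ## (2) the zero extensions and their whole-space classes
  set ũ : ℝ × E → E := zeroExt Q₀ u with hũ
  set Gt : ℝ × E → E →L[ℝ] E := zeroExt Q₀ G with hGt
  have hũ2 : MemLp ũ 2 volume := memLp_zeroExt hQ₀S hSm hu2S
  have hGt2 : MemLp Gt 2 volume := memLp_zeroExt hQ₀S hSm hG2S
  have hũi : LocallyIntegrable ũ volume := locallyIntegrable_zeroExt huI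
  have hGti : LocallyIntegrable Gt volume := locallyIntegrable_zeroExt hGI
  -- ## (3) the mollifiers and the mollified fields
  obtain ⟨bump, hbr, -⟩ := FunctionSpaces.exists_contDiffBump_seq (E := ℝ × E)
  set k : ℕ → ℝ × E → ℝ := fun n => (bump n).normed volume with hk
  have hkinf : ∀ n, ContDiff ℝ (⊤ : ℕ∞) (k n) := fun n => (bump n).contDiff_normed
  have hkr : ∀ n w, w ∉ closedBall (0 : ℝ × E) (bump n).rOut → k n w = 0 := fun n w hw => by
    have : w ∉ Function.support (k n) := by
      rw [hk, (bump n).support_normed_eq]; exact fun h => hw (ball_subset_closedBall h)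
    simpa using this
  have hkc : ∀ n, HasCompactSupport (k n) := fun n => (bump n).hasCompactSupport_normed
  set V : ℕ → ℝ → E → E := fun n => stMollify (k n) ũ with hV
  set Gm : ℕ → ℝ → E → (E →L[ℝ] E) := fun n => stMollify (k n) Gt with hGm
  have hVsm : ∀ n, ContDiff ℝ (⊤ : ℕ∞) (uncurry (V n)) := fun n =>
    contDiff_uncurry_stMollify (hkinf n) (hkc n) hũi
  have hGsm : ∀ n, ContDiff ℝ (⊤ : ℕ∞) (uncurry (Gm n)) := fun n =>
    contDiff_uncurry_stMollify (hkinf n) (hkc n) hGti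
  have hVs1 : ∀ n s, ContDiff ℝ 1 (V n s) := fun n s =>
    (contDiff_stMollify_slice (hkinf n) (hkc n) hũi s).of_le one_le_infty
  -- whole-space convergence and classes of the mollifications
  have cV2 : Tendsto (fun n => eLpNorm (uncurry (V n) - ũ) 2 volume) atTop (𝓝 0) :=
    FunctionSpaces.tendsto_eLpNorm_normed_convolution_sub_self hbr (by norm_num) (by norm_num) hũ2
  have cG : Tendsto (fun n => eLpNorm (uncurry (Gm n) - Gt) 2 volume) atTop (𝓝 0) :=
    FunctionSpaces.tendsto_eLpNorm_normed_convolution_sub_self hbr (by norm_num) (by norm_num) hGt2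
  have mV2 : ∀ n, MemLp (uncurry (V n)) 2 volume := fun n =>
    UnboundedOperators.memLp_convolution_lsmul (bump n).integrable_normed hũ2 (by norm_num)
  have mG : ∀ n, MemLp (uncurry (Gm n)) 2 volume := fun n =>
    UnboundedOperators.memLp_convolution_lsmul (bump n).integrable_normed hGt2 (by norm_num)
  -- ## (4) `∇Vₙ = Gₙ` on `K` for small radii
  have hG₀ : HasWeakSpatialGradientOn Q₀ u G := hG.mono hQ₀Q
  have hEQK : ∀ n, (bump n).rOut < δ → ∀ s y, (s, y) ∈ K →
      fderiv ℝ (V n s) y = Gm n s y := by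
    intro n hn s y hz
    have hsub : closedBall ((s, y) : ℝ × E) (bump n).rOut ⊆ (Q₀ : Set (ℝ × E)) :=
      hballS _ hz _ hn
    exact hG₀.fderiv_mollified huI hGI (hkinf n) (hkr n) hsub
  -- `⟪∇Vₙ X, Vₙ⟫ = ⟪Gₙ X, Vₙ⟫` everywhere for small radii (both vanish off `K`)
  have hEQX : ∀ n, (bump n).rOut < δ → ∀ s y,
      ⟪fderiv ℝ (V n s) y (X s y), V n s y⟫ = ⟪Gm n s y (X s y), V n s y⟫ := by
    intro n hn s y
    by_cases hz : (s, y) ∈ K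
    · rw [hEQK n hn s y hz]
    · rw [hXK s y hz, map_zero, map_zero]
  -- ## (5) the slice identity, integrated in time
  have hXc : ∀ s, HasCompactSupport (X s) := hasCompactSupport_slice_of_compact hK hXK
  have hdivK : ∀ z : ℝ × E, z ∉ K → VectorCalculus.divergence (X z.1) z.2 = 0 := fun z hz =>
    divergence_slice_eq_zero_of_notMem hKc hXK (s := z.1) (y := z.2) hz
  have hslice : ∀ n, (bump n).rOut < δ → ∀ s,
      ∫ y, ⟪Gm n s y (X s y), V n s y⟫ =
        -(1 / 2 : ℝ) * ∫ y, ‖V n s y‖ ^ 2 * VectorCalculus.divergence (X s) y := by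
    intro n hn s
    rw [← integral_inner_fderiv_apply_eq_of_hasCompactSupport (hVs1 n s) (hX1 s) (hXc s)]
    exact integral_congr_ae (Eventually.of_forall fun y => (hEQX n hn s y).symm)
  -- the two space–time integrands and their integrability
  set F₁ : ℕ → ℝ × E → ℝ := fun n z => ⟪Gm n z.1 z.2 (X z.1 z.2), V n z.1 z.2⟫ with hF₁
  set F₂ : ℕ → ℝ × E → ℝ := fun n z =>
    ‖V n z.1 z.2‖ ^ 2 * VectorCalculus.divergence (X z.1) z.2 with hF₂
  have hKμ : (volume : Measure (ℝ × E)) K ≠ ⊤ := hK.measure_lt_top.ne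
  have cVn : ∀ n, Continuous (uncurry (V n)) := fun n => (hVsm n).continuous
  have cGn : ∀ n, Continuous (uncurry (Gm n)) := fun n => (hGsm n).continuous
  have iF₁ : ∀ n, Integrable (F₁ n) (volume : Measure (ℝ × E)) := by
    intro n
    obtain ⟨CV, hCV⟩ := hK.exists_bound_of_continuousOn (cVn n).continuousOn
    obtain ⟨CG, hCG⟩ := hK.exists_bound_of_continuousOn (cGn n).continuousOn
    have hm0 : AEStronglyMeasurable (fun z : ℝ × E => uncurry (Gm n) z (uncurry X z)) volume :=
      isBoundedBilinearMap_apply.continuous.comp_aestronglyMeasurable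
        ((cGn n).aestronglyMeasurable.prodMk hXm)
    have hm : AEStronglyMeasurable (F₁ n) volume := hm0.inner (cVn n).aestronglyMeasurable
    have hF0 : ∀ z : ℝ × E, z ∉ K → F₁ n z = 0 := fun z hz => by
      simp only [hF₁]; rw [hXK z.1 z.2 hz, map_zero, inner_zero_left]
    refine integrable_of_bounded_of_support_subset hKμ hm hF0 (C := max (CG * CX * CV) 0) ?_
    filter_upwards [hCX] with z hzX
    by_cases hz : z ∈ K
    · refine le_trans ?_ (le_max_left _ _)
      calc ‖F₁ n z‖ ≤ ‖Gm n z.1 z.2 (X z.1 z.2)‖ * ‖V n z.1 z.2‖ := norm_inner_le_norm _ _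
        _ ≤ (‖Gm n z.1 z.2‖ * ‖X z.1 z.2‖) * ‖V n z.1 z.2‖ := by
            gcongr; exact le_opNorm _ _
        _ ≤ (CG * CX) * CV := by
            have h1 : ‖Gm n z.1 z.2‖ ≤ CG := hCG z hz
            have h2 : ‖V n z.1 z.2‖ ≤ CV := hCV z hz
            have h0 : 0 ≤ CG := (norm_nonneg _).trans h1
            gcongr
            exact mul_nonneg h0 ((norm_nonneg _).trans hzX)
    · rw [hF0 z hz, norm_zero]; exact le_max_right _ _
  have iF₂ : ∀ n, Integrable (F₂ n) (volume : Measure (ℝ × E)) := by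
    intro n
    obtain ⟨CV, hCV⟩ := hK.exists_bound_of_continuousOn (cVn n).continuousOn
    have hm : AEStronglyMeasurable (F₂ n) volume :=
      (((cVn n).norm.pow 2).aestronglyMeasurable).mul hdm
    have hF0 : ∀ z : ℝ × E, z ∉ K → F₂ n z = 0 := fun z hz => by
      simp only [hF₂]; rw [hdivK z hz, mul_zero]
    refine integrable_of_bounded_of_support_subset hKμ hm hF0 (C := max (CV ^ 2 * Cd) 0) ?_
    filter_upwards [hCd] with z hzd
    by_cases hz : z ∈ K
    · refine le_trans ?_ (le_max_left _ _)
      rw [hF₂, norm_mul, norm_pow, norm_norm, Real.norm_eq_abs]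
      have h2 : ‖V n z.1 z.2‖ ≤ CV := hCV z hz
      have h0 : 0 ≤ CV := (norm_nonneg _).trans h2
      gcongr
    · rw [hF0 z hz, norm_zero]; exact le_max_right _ _
  have hID : ∀ n, (bump n).rOut < δ →
      ∫ z, F₁ n z = -(1 / 2 : ℝ) * ∫ z, F₂ n z := by
    intro n hn
    have hvol : (volume : Measure (ℝ × E)) = (volume : Measure ℝ).prod (volume : Measure E) :=
      Measure.volume_eq_prod _ _
    have i1 : Integrable (F₁ n) ((volume : Measure ℝ).prod (volume : Measure E)) := by
      rw [← hvol]; exact iF₁ n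
    have i2 : Integrable (F₂ n) ((volume : Measure ℝ).prod (volume : Measure E)) := by
      rw [← hvol]; exact iF₂ n
    rw [hvol, integral_prod (F₁ n) i1, integral_prod (F₂ n) i2, ← integral_const_mul]
    refine integral_congr_ae (Eventually.of_forall fun s => ?_)
    exact hslice n hn s
  -- ## (6) the weights and the bilinear forms
  set wX : Fin (finrank ℝ E) → ℝ × E → ℝ := fun i z => ⟪X z.1 z.2, b i⟫ with hwX
  set wd : ℝ × E → ℝ := fun z => VectorCalculus.divergence (X z.1) z.2 with hwd
  have mwX : ∀ i, AEStronglyMeasurable (wX i) volume := fun i =>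
    hXm.inner aestronglyMeasurable_const
  have mwd : AEStronglyMeasurable wd volume := hdm
  have bwX : ∀ i, ∀ᵐ z ∂(volume : Measure (ℝ × E)), ‖wX i z‖ ≤ CX := fun i => by
    filter_upwards [hCX] with z hz
    calc ‖wX i z‖ ≤ ‖X z.1 z.2‖ * ‖b i‖ := norm_inner_le_norm _ _
      _ = ‖X z.1 z.2‖ := by rw [b.orthonormal.1 i, mul_one]
      _ ≤ CX := hz
  have bwd : ∀ᵐ z ∂(volume : Measure (ℝ × E)), ‖wd z‖ ≤ Cd := by
    filter_upwards [hCd] with z hz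
    rw [Real.norm_eq_abs]; exact hz
  set βI : E →L[ℝ] E →L[ℝ] ℝ := innerSL ℝ with hβI
  set βA : Fin (finrank ℝ E) → (E →L[ℝ] E) →L[ℝ] E →L[ℝ] ℝ := fun i =>
    (innerSL ℝ).comp (ContinuousLinearMap.apply ℝ E (b i)) with hβA
  have βA_apply : ∀ i (L : E →L[ℝ] E) (v : E), βA i L v = ⟪L (b i), v⟫ := fun i L v => by
    simp [hβA]
  have βI_apply : ∀ x y : E, βI x y = ⟪x, y⟫ := fun x y => rfl
  haveI hHT22 : ENNReal.HolderTriple 2 2 1 := ENNReal.HolderConjugate.instTwoTwo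
  -- expansion of `⟪L (X), v⟫` along the basis
  have expand : ∀ (L : E →L[ℝ] E) (x v : E), ⟪L x, v⟫ = ∑ i, ⟪x, b i⟫ * ⟪L (b i), v⟫ := by
    intro L x v
    conv_lhs => rw [← b.sum_repr' x]
    rw [map_sum, sum_inner]
    refine Finset.sum_congr rfl fun i _ => ?_
    rw [map_smul, real_inner_smul_left, real_inner_comm (b i) x]
  have pw₁ : ∀ n (z : ℝ × E), F₁ n z = ∑ i, wX i z * βA i (uncurry (Gm n) z) (uncurry (V n) z) := by
    intro n z
    simp only [hF₁, hwX, βA_apply, uncurry]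
    exact expand _ _ _
  have pw₂ : ∀ n (z : ℝ × E), F₂ n z = wd z * βI (uncurry (V n) z) (uncurry (V n) z) := by
    intro n z
    simp only [hF₂, hwd, βI_apply, uncurry, real_inner_self_eq_norm_sq, mul_comm]
  -- ## (7) the limits
  have lim₁ : ∀ i, Tendsto (fun n => ∫ z in univ, wX i z * βA i (uncurry (Gm n) z) (uncurry (V n) z))
      atTop (𝓝 (∫ z in univ, wX i z * βA i (Gt z) (ũ z))) := fun i =>
    tendsto_setIntegral_mul_bilin (p := 2) (q := 2) one_le_two (βA i) mG hGt2 mV2 hũ2 cG cV2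
      (mwX i) (bwX i) univ
  have lim₂ : Tendsto (fun n => ∫ z in univ, wd z * βI (uncurry (V n) z) (uncurry (V n) z))
      atTop (𝓝 (∫ z in univ, wd z * βI (ũ z) (ũ z))) :=
    tendsto_setIntegral_mul_bilin (p := 2) (q := 2) one_le_two βI mV2 hũ2 mV2 hũ2 cV2 cV2 mwd
      bwd univ
  have i₁ : ∀ n i, Integrable (fun z => wX i z * βA i (uncurry (Gm n) z) (uncurry (V n) z))
      (volume : Measure (ℝ × E)) := fun n i =>
    integrable_mul_bilin_of_memLp (p := 2) (q := 2) _ (mG n) (mV2 n) (mwX i) (bwX i)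
  have hIDT : ∀ n, (bump n).rOut < δ →
      ∑ i, ∫ z in univ, wX i z * βA i (uncurry (Gm n) z) (uncurry (V n) z) =
        -(1 / 2 : ℝ) * ∫ z in univ, wd z * βI (uncurry (V n) z) (uncurry (V n) z) := by
    intro n hn
    have h := hID n hn
    rw [integral_congr_ae (Eventually.of_forall (pw₁ n)), integral_finsetSum _ (fun i _ => i₁ n i),
      integral_congr_ae (Eventually.of_forall (pw₂ n))] at h
    simp only [Measure.restrict_univ]
    exact h
  have hev : ∀ᶠ n in atTop, (bump n).rOut < δ := (tendsto_order.1 hbr).2 δ hδ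
  have I1 : ∑ i, ∫ z in univ, wX i z * βA i (Gt z) (ũ z) =
      -(1 / 2 : ℝ) * ∫ z in univ, wd z * βI (ũ z) (ũ z) :=
    tendsto_nhds_unique_of_eventuallyEq (tendsto_finsetSum _ fun i _ => lim₁ i)
      (lim₂.const_mul _) (hev.mono fun n hn => hIDT n hn)
  -- ## (8) identification of the limits
  have hũu : ∀ z ∈ S, ũ z = u z.1 z.2 := fun z hz => zeroExt_of_mem _ hz
  have hGtG : ∀ z ∈ S, Gt z = G z.1 z.2 := fun z hz => zeroExt_of_mem _ hz
  have hKof : ∀ z, z ∉ S → z ∉ K := fun z hz h' => hz (hKS h')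
  have hrestr : ∀ {g : ℝ × E → ℝ}, (∀ z, z ∉ K → g z = 0) →
      ∫ z in univ, g z = ∫ z in (Q : Set (ℝ × E)), g z := fun {g} hg => by
    rw [Measure.restrict_univ]
    exact (setIntegral_eq_integral_of_forall_compl_eq_zero fun z hz => hg z fun h' => hz (hKQ h')).symm
  have e₁ : ∀ z ∈ (Q : Set (ℝ × E)), (∑ i, wX i z * βA i (Gt z) (ũ z)) =
      ⟪G z.1 z.2 (X z.1 z.2), u z.1 z.2⟫ := by
    intro z _
    by_cases hzS : z ∈ S
    · rw [hGtG z hzS, hũu z hzS, expand]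
      simp only [hwX, βA_apply]
    · have h0 : X z.1 z.2 = 0 := hXK z.1 z.2 (hKof z hzS)
      simp only [hwX, h0, inner_zero_left, zero_mul, Finset.sum_const_zero, map_zero]
  have e₂ : ∀ z ∈ (Q : Set (ℝ × E)), wd z * βI (ũ z) (ũ z) =
      ‖u z.1 z.2‖ ^ 2 * VectorCalculus.divergence (X z.1) z.2 := by
    intro z _
    by_cases hzS : z ∈ S
    · rw [βI_apply, real_inner_self_eq_norm_sq, hũu z hzS, mul_comm]
    · have h0 : wd z = 0 := hdivK z (hKof z hzS)
      rw [h0, zero_mul, show VectorCalculus.divergence (X z.1) z.2 = 0 from hdivK z (hKof z hzS),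
        mul_zero]
  have iL₁ : ∀ i, Integrable (fun z => wX i z * βA i (Gt z) (ũ z)) (volume : Measure (ℝ × E)) :=
    fun i => integrable_mul_bilin_of_memLp (p := 2) (q := 2) _ hGt2 hũ2 (mwX i) (bwX i)
  have v₁ : ∀ z, z ∉ K → (∑ i, wX i z * βA i (Gt z) (ũ z)) = 0 := fun z hz => by
    have h0 : X z.1 z.2 = 0 := hXK z.1 z.2 hz
    simp only [hwX, h0, inner_zero_left, zero_mul, Finset.sum_const_zero]
  have v₂ : ∀ z, z ∉ K → wd z * βI (ũ z) (ũ z) = 0 := fun z hz => by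
    have h0 : wd z = 0 := hdivK z hz
    rw [h0, zero_mul]
  have c₁ : ∑ i, ∫ z in univ, wX i z * βA i (Gt z) (ũ z) =
      ∫ z in (Q : Set (ℝ × E)), ⟪G z.1 z.2 (X z.1 z.2), u z.1 z.2⟫ := by
    rw [← integral_finsetSum _ fun i _ => (iL₁ i).integrableOn, hrestr v₁]
    exact setIntegral_congr_fun hQm e₁
  have c₂ : ∫ z in univ, wd z * βI (ũ z) (ũ z) =
      ∫ z in (Q : Set (ℝ × E)), ‖u z.1 z.2‖ ^ 2 * VectorCalculus.divergence (X z.1) z.2 := by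
    rw [hrestr v₂]
    exact setIntegral_congr_fun hQm e₂
  rw [← c₁, ← c₂]
  exact I1

end Main

/-! ### The drift and dilation forms against a test function -/

section Corollaries

variable {Q : Opens (ℝ × E)} {u : ℝ → E → E} {G : ℝ → E → E →L[ℝ] E}

omit [MeasurableSpace E] [BorelSpace E] in
/-- Bounds and vanishing of a test function and its spatial gradient: `|φ| ≤ C_φ`, `|∇φ| ≤ C_g`
everywhere, both vanishing off `supp φ`. [folklore] -/
theorem IsSpaceTimeTestOn.exists_bound_self_and_gradient {φ : ℝ → E → ℝ}
    (hφ : IsSpaceTimeTestOn Q φ) :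
    ∃ Cφ Cg : ℝ, 0 ≤ Cφ ∧ 0 ≤ Cg ∧ (∀ s y, ‖φ s y‖ ≤ Cφ) ∧ (∀ s y, ‖gradient (φ s) y‖ ≤ Cg) ∧
      Continuous (uncurry fun s y => gradient (φ s) y) := by
  have cφ : Continuous (uncurry φ) := hφ.contDiff.continuous
  have cgφ : Continuous (uncurry fun s y => gradient (φ s) y) :=
    ((hφ.isSmoothSpaceTimeOn univ).gradient uniqueDiffOn_univ).continuous_uncurry
  obtain ⟨Cφ, hCφ⟩ := cφ.bounded_above_of_compact_support hφ.hasCompactSupport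
  have hgs : HasCompactSupport (uncurry fun s y => gradient (φ s) y) :=
    HasCompactSupport.intro hφ.hasCompactSupport fun z hz =>
      (weights_eq_zero_of_notMem_tsupport hz).2.1
  obtain ⟨Cg, hCg⟩ := cgφ.bounded_above_of_compact_support hgs
  refine ⟨max Cφ 0, max Cg 0, le_max_right _ _, le_max_right _ _,
    fun s y => (hCφ (s, y)).trans (le_max_left _ _),
    fun s y => (hCg (s, y)).trans (le_max_left _ _), cgφ⟩

set_option maxHeartbeats 400000 in
/-- **The drift form: `∫∫_Q ⟪G (b), u⟫ φ = -½ ∫∫_Q |u|² ⟪b, ∇φ⟫` for a divergence-free drift.**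
Let `u` have the weak spatial gradient `G` on `Q` with `|u|², |G|² ∈ L¹_loc(Q)`, let the drift
`b : ℝ → E → E` be `C¹` in space for every time, jointly measurable, divergence free a.e. on
`ℝ × E`, and a.e. bounded on the support of the test function `φ ∈ C_c^∞(Q)` (no time regularity:
e.g. a space-mollified velocity `η_ε * U(s)`, or a `C¹` profile). Then
`∫∫_Q ⟪G (b), u⟫ φ = -½ ∫∫_Q |u|² ⟪b, ∇φ⟫` — the weak form of `⟪(b·∇)u, u⟫φ = ½ b·∇(|u|²) φ` after
integration by parts with `div b = 0`: the transport term `½ |u|² (b·∇φ)` of local energy balances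
(Caffarelli–Kohn–Nirenberg 1982, (2.5), where `b = u`; Bradshaw–Tsai 2017, proof of Thm. 2.4,
`b = W + η_ε * U`). [cite: CaffarelliKohnNirenberg1982, §2 (2.5); BradshawTsai2017AHP, proof of Thm. 2.4 (local energy equality of the approximants)] -/
theorem HasWeakSpatialGradientOn.integral_inner_apply_drift_mul_eq
    (hG : HasWeakSpatialGradientOn Q u G)
    (hu2 : LocallyIntegrableOn (fun z : ℝ × E => ‖u z.1 z.2‖ ^ 2) (Q : Set (ℝ × E)) volume)
    (hG2 : LocallyIntegrableOn (fun z : ℝ × E => frobeniusNormSq (G z.1 z.2)) (Q : Set (ℝ × E))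
      volume)
    {φ : ℝ → E → ℝ} (hφ : IsSpaceTimeTestOn Q φ)
    {b : ℝ → E → E} (hb1 : ∀ s, ContDiff ℝ 1 (b s))
    (hbdiv : ∀ᵐ z : ℝ × E, VectorCalculus.divergence (b z.1) z.2 = 0)
    (hbm : AEStronglyMeasurable (uncurry b) (volume : Measure (ℝ × E)))
    {Cb : ℝ} (hCb : ∀ᵐ z : ℝ × E, z ∈ tsupport (uncurry φ) → ‖b z.1 z.2‖ ≤ Cb) :
    ∫ z in (Q : Set (ℝ × E)), ⟪G z.1 z.2 (b z.1 z.2), u z.1 z.2⟫ * φ z.1 z.2 =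
      -(1 / 2 : ℝ) * ∫ z in (Q : Set (ℝ × E)),
        ‖u z.1 z.2‖ ^ 2 * ⟪b z.1 z.2, gradient (φ z.1) z.2⟫ := by
  obtain ⟨Cφ, Cg, hCφ0, hCg0, hCφ, hCg, cgφ⟩ := hφ.exists_bound_self_and_gradient
  set K : Set (ℝ × E) := tsupport (uncurry φ) with hK_def
  have hK : IsCompact K := hφ.hasCompactSupport
  have hKQ : K ⊆ (Q : Set (ℝ × E)) := hφ.tsupport_subset
  set X : ℝ → E → E := fun s y => φ s y • b s y with hX_def
  have hφs : ∀ s, ContDiff ℝ 1 (φ s) := fun s => (contDiff_slice hφ.contDiff s).of_le one_le_infty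
  have h0 : ∀ z : ℝ × E, z ∉ K → φ z.1 z.2 = 0 ∧ gradient (φ z.1) z.2 = 0 := fun z hz =>
    ⟨(weights_eq_zero_of_notMem_tsupport hz).1, (weights_eq_zero_of_notMem_tsupport hz).2.1⟩
  have hXK : ∀ s y, (s, y) ∉ K → X s y = 0 := fun s y hz => by
    simp only [hX_def, (h0 (s, y) hz).1, zero_smul]
  have hX1 : ∀ s, ContDiff ℝ 1 (X s) := fun s => (hφs s).smul (hb1 s)
  have hXm : AEStronglyMeasurable (uncurry X) (volume : Measure (ℝ × E)) :=
    hφ.contDiff.continuous.aestronglyMeasurable.smul hbm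
  -- `div X = φ div b + ⟪b, ∇φ⟫ = ⟪b, ∇φ⟫` a.e.
  have hdiv : ∀ s y, VectorCalculus.divergence (X s) y =
      φ s y * VectorCalculus.divergence (b s) y + ⟪b s y, gradient (φ s) y⟫ := fun s y => by
    rw [hX_def, divergence_smul_apply ((hφs s).differentiable one_ne_zero y)
      ((hb1 s).differentiable one_ne_zero y)]
  have hdae : (fun z : ℝ × E => VectorCalculus.divergence (X z.1) z.2) =ᵐ[volume]
      fun z => ⟪b z.1 z.2, gradient (φ z.1) z.2⟫ := by
    filter_upwards [hbdiv] with z hz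
    rw [hdiv, hz, mul_zero, zero_add]
  have hgm : AEStronglyMeasurable (fun z : ℝ × E => ⟪b z.1 z.2, gradient (φ z.1) z.2⟫)
      (volume : Measure (ℝ × E)) := hbm.inner cgφ.aestronglyMeasurable
  have hdm : AEStronglyMeasurable (fun z : ℝ × E => VectorCalculus.divergence (X z.1) z.2)
      (volume : Measure (ℝ × E)) := hgm.congr hdae.symm
  have hCX : ∀ᵐ z : ℝ × E, ‖X z.1 z.2‖ ≤ Cφ * max Cb 0 := by
    filter_upwards [hCb] with z hzb
    by_cases hz : z ∈ K
    · rw [hX_def, norm_smul]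
      exact mul_le_mul (hCφ z.1 z.2) ((hzb hz).trans (le_max_left _ _)) (norm_nonneg _) hCφ0
    · rw [hXK z.1 z.2 hz, norm_zero]; positivity
  have hCd : ∀ᵐ z : ℝ × E, |VectorCalculus.divergence (X z.1) z.2| ≤ max Cb 0 * Cg := by
    filter_upwards [hCb, hdae] with z hzb hzd
    rw [hzd]
    by_cases hz : z ∈ K
    · rw [← Real.norm_eq_abs]
      exact (norm_inner_le_norm _ _).trans
        (mul_le_mul ((hzb hz).trans (le_max_left _ _)) (hCg z.1 z.2) (norm_nonneg _)
          (le_max_right _ _))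
    · rw [(h0 z hz).2, inner_zero_right, abs_zero]; positivity
  have h := hG.integral_inner_apply_field_eq hu2 hG2 hK hKQ hXK hX1 hXm hdm hCX hCd
  have hR : ∫ z in (Q : Set (ℝ × E)), ‖u z.1 z.2‖ ^ 2 * VectorCalculus.divergence (X z.1) z.2 =
      ∫ z in (Q : Set (ℝ × E)), ‖u z.1 z.2‖ ^ 2 * ⟪b z.1 z.2, gradient (φ z.1) z.2⟫ := by
    refine integral_congr_ae (ae_restrict_of_ae ?_)
    filter_upwards [hdae] with z hz
    rw [hz]
  rw [hR] at h
  rw [← h]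
  refine setIntegral_congr_fun Q.isOpen.measurableSet fun z _ => ?_
  simp only [hX_def, map_smul, real_inner_smul_left, mul_comm]

omit [MeasurableSpace E] [BorelSpace E] in
/-- `div (y ↦ y) = dim E` (a private copy of `divergence_id_eq_finrank` of
`WeightedVelocityBounds`, to keep the imports of this file light). [folklore] -/
private theorem divergence_id_eq_finrank' (y : E) :
    VectorCalculus.divergence (fun y : E => y) y = (finrank ℝ E : ℝ) := by
  simp [VectorCalculus.divergence, LinearMap.trace_id]

set_option maxHeartbeats 400000 in
/-- **The dilation form: `∫∫_Q ⟪G (y), u⟫ φ = -½ ∫∫_Q |u|² (n φ + ⟪y, ∇φ⟫)`, `n = dim E`.**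
Let `u` have the weak spatial gradient `G` on `Q` with `|u|², |G|² ∈ L¹_loc(Q)` and let
`φ ∈ C_c^∞(Q)`. Then `∫∫_Q ⟪G (y), u⟫ φ = -½ ∫∫_Q |u|² (n φ + ⟪y, ∇φ⟫)` — the weak form of
`⟪(y·∇)u, u⟫φ = ½ y·∇(|u|²) φ` after integration by parts (`div (φ y) = n φ + y·∇φ`): the
dilation term `y·∇u` of the Leray system in similarity variables (Bradshaw–Tsai 2017, proof of
Thm. 2.4, local energy equality of the approximants). [cite: BradshawTsai2017AHP, proof of Thm. 2.4 (local energy equality of the approximants); CaffarelliKohnNirenberg1982, §2 (2.5)] -/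
theorem HasWeakSpatialGradientOn.integral_inner_apply_self_mul_eq
    (hG : HasWeakSpatialGradientOn Q u G)
    (hu2 : LocallyIntegrableOn (fun z : ℝ × E => ‖u z.1 z.2‖ ^ 2) (Q : Set (ℝ × E)) volume)
    (hG2 : LocallyIntegrableOn (fun z : ℝ × E => frobeniusNormSq (G z.1 z.2)) (Q : Set (ℝ × E))
      volume)
    {φ : ℝ → E → ℝ} (hφ : IsSpaceTimeTestOn Q φ) :
    ∫ z in (Q : Set (ℝ × E)), ⟪G z.1 z.2 z.2, u z.1 z.2⟫ * φ z.1 z.2 =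
      -(1 / 2 : ℝ) * ∫ z in (Q : Set (ℝ × E)),
        ‖u z.1 z.2‖ ^ 2 * ((finrank ℝ E : ℝ) * φ z.1 z.2 + ⟪z.2, gradient (φ z.1) z.2⟫) := by
  obtain ⟨Cφ, Cg, hCφ0, hCg0, hCφ, hCg, cgφ⟩ := hφ.exists_bound_self_and_gradient
  set K : Set (ℝ × E) := tsupport (uncurry φ) with hK_def
  have hK : IsCompact K := hφ.hasCompactSupport
  have hKQ : K ⊆ (Q : Set (ℝ × E)) := hφ.tsupport_subset
  obtain ⟨R, hR⟩ := hK.isBounded.exists_norm_le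
  set X : ℝ → E → E := fun s y => φ s y • y with hX_def
  have hφs : ∀ s, ContDiff ℝ 1 (φ s) := fun s => (contDiff_slice hφ.contDiff s).of_le one_le_infty
  have h0 : ∀ z : ℝ × E, z ∉ K → φ z.1 z.2 = 0 ∧ gradient (φ z.1) z.2 = 0 := fun z hz =>
    ⟨(weights_eq_zero_of_notMem_tsupport hz).1, (weights_eq_zero_of_notMem_tsupport hz).2.1⟩
  have hXK : ∀ s y, (s, y) ∉ K → X s y = 0 := fun s y hz => by
    simp only [hX_def, (h0 (s, y) hz).1, zero_smul]
  have hX1 : ∀ s, ContDiff ℝ 1 (X s) := fun s => (hφs s).smul contDiff_id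
  have hXm : AEStronglyMeasurable (uncurry X) (volume : Measure (ℝ × E)) :=
    (hφ.contDiff.continuous.smul continuous_snd).aestronglyMeasurable
  have hdiv : ∀ s y, VectorCalculus.divergence (X s) y =
      (finrank ℝ E : ℝ) * φ s y + ⟪y, gradient (φ s) y⟫ := by
    intro s y
    show VectorCalculus.divergence (fun y => φ s y • y) y = _
    rw [divergence_smul_apply ((hφs s).differentiable one_ne_zero y) differentiableAt_fun_id,
      divergence_id_eq_finrank', mul_comm]
  have hdX : (fun z : ℝ × E => VectorCalculus.divergence (X z.1) z.2) =
      fun z => (finrank ℝ E : ℝ) * φ z.1 z.2 + ⟪z.2, gradient (φ z.1) z.2⟫ :=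
    funext fun z => hdiv z.1 z.2
  have hdm : AEStronglyMeasurable (fun z : ℝ × E => VectorCalculus.divergence (X z.1) z.2)
      (volume : Measure (ℝ × E)) := by
    rw [hdX]
    exact ((continuous_const.mul hφ.contDiff.continuous).add
      (continuous_snd.inner cgφ)).aestronglyMeasurable
  have hR0 : 0 ≤ max R 0 := le_max_right _ _
  have hRz : ∀ z : ℝ × E, z ∈ K → ‖z.2‖ ≤ max R 0 := fun z hz =>
    (norm_snd_le z).trans ((hR z hz).trans (le_max_left _ _))
  have hCX : ∀ z : ℝ × E, ‖X z.1 z.2‖ ≤ Cφ * max R 0 := by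
    intro z
    by_cases hz : z ∈ K
    · rw [hX_def, norm_smul]
      exact mul_le_mul (hCφ z.1 z.2) (hRz _ hz) (norm_nonneg _) hCφ0
    · rw [hXK z.1 z.2 hz, norm_zero]; positivity
  have hCd : ∀ z : ℝ × E, |VectorCalculus.divergence (X z.1) z.2| ≤
      (finrank ℝ E : ℝ) * Cφ + max R 0 * Cg := by
    intro z
    rw [hdiv]
    by_cases hz : z ∈ K
    · refine (abs_add_le _ _).trans (add_le_add ?_ ?_)
      · rw [abs_mul, Nat.abs_cast]
        exact mul_le_mul_of_nonneg_left ((Real.norm_eq_abs _).symm.le.trans (hCφ z.1 z.2))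
          (Nat.cast_nonneg _)
      · rw [← Real.norm_eq_abs]
        exact (norm_inner_le_norm _ _).trans
          (mul_le_mul (hRz _ hz) (hCg z.1 z.2) (norm_nonneg _) hR0)
    · rw [(h0 z hz).1, (h0 z hz).2, inner_zero_right, mul_zero, add_zero, abs_zero]
      positivity
  have h := hG.integral_inner_apply_field_eq hu2 hG2 hK hKQ hXK hX1 hXm hdm
    (Eventually.of_forall hCX) (Eventually.of_forall hCd)
  simp_rw [hdiv] at h
  rw [← h]
  refine setIntegral_congr_fun Q.isOpen.measurableSet fun z _ => ?_
  simp only [hX_def, map_smul, real_inner_smul_left, mul_comm]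

end Corollaries


end Literature.Analysis.FluidPDE
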